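import Literature.InformationTheory.QuantumCodes.MatchingDecoders
import Literature.InformationTheory.QuantumCodes.ToricCodePhenomenological
import Literature.InformationTheory.QuantumCodes.SyndromeDecodingCSS
import HarnessLib

/-!
# Matching decoders for the toric code: the star, plaquette and space-time syndrome maps are graphlike,
# so MWPM decoding is minimum-weight decoding (perfect and noisy syndrome measurement)

Topic `Literature/InformationTheory/QuantumCodes` (venture QEC, LADDER-QEC rung Q5 «toric/surface + MWPM»;
qec-type-09 gen 4). Companion of `MatchingDecoders.lean` (the Edmonds–Johnson / Korte–Vygen theorem
`IsMatchingDecoder.isMinWeight` for graphlike syndrome maps) and of the toric-code files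
`ToricCodeThreshold.lean` (perfect measurement: chains `Chain L`, boundary `syn L = starMatrix L *ᵥ ·`,
`cycles L`, decoders `ZDecoder L`) and `ToricCodePhenomenological.lean` (`T` noisy rounds: histories on the
space-time links `STLink L T`, boundary `stSyn L T = stMatrix L T *ᵥ ·`, `stCycles L T`, `STDecoder L T`).
Dennis–Kitaev–Landahl–Preskill decode both by minimum-weight perfect matching: "the minimum weight chain with
a specified boundary, which we know can be computed in a time polynomial in `L` using the perfect matching
algorithm of Edmonds" (§4.4 p. 18); "Given the measured syndrome, and hence its boundary `∂S`, the minimal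
chain `E_min` can be determined on a classical computer, using standard algorithms, in a time bounded by a
polynomial of the number of lattice sites [edmonds, barahona_match]" (§5.1 p. 19, the three-dimensional
space-time lattice). This file PROVES (0 facts, kernel axioms) that the three boundary maps of the toric code
ARE incidence matrices of explicit link-end maps, so that every matching decoder for them is a minimum-weight
decoder in the sense consumed by all toric threshold / radius theorems of the tree:

* `starEnds L (v, i) = s(v, v + eᵢ)` — `starMatrix L = incMatrix (starEnds L)` (`starMatrix_eq_incMatrix`),
  hence `syn L = graphSyn (starEnds L)`, `cycles L = graphCycles (starEnds L)` and
  **`isMinWeight_of_isMatchingDecoder_star`**: `IsMatchingDecoder m D → D.IsMinWeight (syn L) (cycles L)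
  hammingNorm` for every link metric `m` (phase flips / `Z`-sector, defects at the sites);
* `plaqEnds L (v, i)` = the two plaquettes bordering the link — `plaquetteMatrix L = incMatrix (plaqEnds L)`,
  **`isMinWeight_of_isMatchingDecoder_plaq`**: matching decoders of the plaquette syndrome are minimum-weight
  decoders `D.IsMinWeight (toricCode L).xSyndrome ↑(toricCode L).kerZ hammingNorm` (bit flips / `X`-sector);
* `stLinkEnds L T` — horizontal link `(ℓ, t)` joins the two sites of `ℓ` in slice `t`, vertical link `(s, t)`
  joins `(s, t)` and `(s, t+1)` — `stMatrix L T = incMatrix (stLinkEnds L T)`,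
  **`isMinWeight_of_isMatchingDecoder_st`**: space-time matching decoders (DKLP's `E_min` by matching in
  the three-dimensional lattice) are minimum-weight space-time decoders
  `D.IsMinWeight (stSyn L T) (stCycles L T) hammingNorm`;
* link-connectivity of the three lattices (`star_isLinkConnected`, `plaq_isLinkConnected`,
  `st_isLinkConnected` for `T ≥ 1`), the canonical shortest-chain metrics `starMetric`, `plaqMetric`,
  `stMetric`, and NON-VACUITY: matching decoders exist (`exists_isMatchingDecoder_star/plaq/st`).
The Summits corollaries (certified thresholds for MWPM families) are in
`Summits/Ventures/QEC/Thresholds/ToricCodeMWPMThresholds.lean`.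

## References
* [DennisEtAl2002] E. Dennis, A. Kitaev, A. Landahl, J. Preskill, *Topological quantum memory*, J. Math.
  Phys. 43 (2002) 4452–4505, arXiv:quant-ph/0110143, §3.1, §4.2–4.4 (p. 18), §5.1 (p. 19).
* [KorteVygen2002] B. Korte, J. Vygen, *Combinatorial Optimization*, 2nd ed., Springer (2002), §12.2
  Thm 12.9 (Edmonds–Johnson).
-/

namespace Literature.InformationTheory.QuantumCodes

open Finset Matrix Literature.Barriers.PneNP
open Literature.Probability.LatticeModels (TorusSite)

namespace ToricCode

variable (L : ℕ)

/-! ### Walking on the torus: chains joining any two sites -/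

/-- Every site of the torus is reached from any other by `(b - a)₀` steps `e₀` and `(b - a)₁` steps `e₁`.
[cite: DennisEtAl2002, §3.1 (L × L square lattice on the torus)] -/
theorem vertex_eq_add_nsmul_dir [NeZero L] (a b : Vertex L) :
    b = a + ((b - a) 0).val • (dir 0 : Vertex L) + ((b - a) 1).val • (dir 1 : Vertex L) := by
  funext j
  fin_cases j <;> simp [-ZMod.natCast_val, dir, ZMod.natCast_zmod_val]

variable {L} in
/-- **Chains along lattice steps.** If a graphlike model on sites `f v` (`v` a torus site) has, for every
site and direction, a link joining `f b` and `f (b + eᵢ)`, then every `f b` is joined to `f a` by a chain.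
[cite: KorteVygen2002, §12.2 Prop 12.6 (paths Pᵢ within a connected component)] -/
theorem exists_chain_of_steps [NeZero L] {V E : Type*} [DecidableEq V] [Fintype E] [DecidableEq E]
    {ι : E → Sym2 V} (f : Vertex L → V) (hstep : ∀ (b : Vertex L) (i : Fin 2), ∃ ℓ, ι ℓ = s(f b, f (b + dir i)))
    (a b : Vertex L) : ∃ γ : E → ZMod 2, graphSyn ι γ = pairIndicator s(f a, f b) := by
  -- one step
  have h1 : ∀ (c : Vertex L) (i : Fin 2), (∃ γ : E → ZMod 2, graphSyn ι γ = pairIndicator s(f a, f c)) →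
      ∃ γ : E → ZMod 2, graphSyn ι γ = pairIndicator s(f a, f (c + dir i)) := by
    rintro c i ⟨γ, hγ⟩
    obtain ⟨ℓ, hℓ⟩ := hstep c i
    refine ⟨γ + Pi.single ℓ 1, ?_⟩
    rw [graphSyn_add, graphSyn_single, hγ, hℓ, pairIndicator_add_pairIndicator]
  -- `n` steps in direction `i`
  have hn : ∀ (n : ℕ) (c : Vertex L) (i : Fin 2), (∃ γ : E → ZMod 2, graphSyn ι γ = pairIndicator s(f a, f c)) →
      ∃ γ : E → ZMod 2, graphSyn ι γ = pairIndicator s(f a, f (c + n • dir i)) := by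
    intro n
    induction n with
    | zero => intro c i h; simpa using h
    | succ k ih =>
      intro c i h
      have := h1 (c + k • dir i) i (ih c i h)
      rwa [add_assoc, ← succ_nsmul] at this
  have h0 : ∃ γ : E → ZMod 2, graphSyn ι γ = pairIndicator s(f a, f a) := ⟨0, by rw [graphSyn_zero, pairIndicator_diag]⟩
  have := hn ((b - a) 1).val _ 1 (hn ((b - a) 0).val a 0 h0)
  rwa [← vertex_eq_add_nsmul_dir L a b] at this

/-! ### The star syndrome map (`Z`-sector, perfect measurement) -/

/-- The two ENDS of the link `(v, i)`: the sites `v` and `v + eᵢ` (the sites whose star operator `X_s`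
contains the link). [cite: DennisEtAl2002, §3.1 (link from site v to v + eᵢ, X_s = ⊗_{ℓ ∋ s} X_ℓ)] -/
def starEnds (ℓ : Edge L) : Sym2 (Vertex L) :=
  s(ℓ.1, ℓ.1 + dir ℓ.2)

/-- **The star check matrix is the incidence matrix of the lattice**: `H^X = incMatrix starEnds` (site `s`
meets link `(v, i)` iff `s = v` or `s = v + eᵢ`, modulo two). [cite: DennisEtAl2002, §3.1 and §4.3 (∂E = the boundary of the chain)] -/
theorem starMatrix_eq_incMatrix : starMatrix L = incMatrix (starEnds L) := by
  ext s ⟨v, i⟩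
  simp only [starMatrix, incMatrix, of_apply, starRow, starEnds, pairIndicator_mk, Pi.add_apply,
    Pi.single_apply, Prod.mk.injEq]
  have h0 : (v = s - dir 0) ↔ (s = v + dir 0) := by rw [eq_sub_iff_add_eq, eq_comm]
  have h1 : (v = s - dir 1) ↔ (s = v + dir 1) := by rw [eq_sub_iff_add_eq, eq_comm]
  have h2 : (v = s) ↔ (s = v) := eq_comm
  fin_cases i <;> simp [h0, h1, h2]

/-- Hence the syndrome map of `Z`-errors is the graphlike boundary of `starEnds`. [cite: DennisEtAl2002, §4.3 (∂S = ∂E)] -/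
theorem syn_eq_graphSyn [NeZero L] : syn L = graphSyn (starEnds L) := by
  funext e
  simp only [syn, graphSyn, starMatrix_eq_incMatrix]

/-- … and the cycles are the graphlike cycles. [cite: DennisEtAl2002, §4.3] -/
theorem cycles_eq_graphCycles [NeZero L] : cycles L = graphCycles (starEnds L) := by
  ext z
  simp only [cycles, graphCycles, Set.mem_setOf_eq, syn_eq_graphSyn]

variable {L} in
/-- **Toric `Z`-sector: matching decoders are minimum-weight decoders.** For every link metric `m` on the
sites (any symmetric weight with the triangle inequality and `≤ 1` across links — e.g. the lattice distance
`starMetric`) and every decoder returning geodesic realisations of a minimum-cost perfect matching of the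
flagged sites, `D.IsMinWeight (syn L) (cycles L) hammingNorm` — the hypothesis of every toric threshold theorem
of the tree. (Korte–Vygen Thm 12.9.) [cite: DennisEtAl2002, §4.4 p. 18 (minimum weight chain … perfect matching algorithm of Edmonds)] -/
theorem isMinWeight_of_isMatchingDecoder_star [NeZero L] {m : EdgeMetric (starEnds L)} {D : ZDecoder L}
    (hD : IsMatchingDecoder m D) : D.IsMinWeight (syn L) (cycles L) hammingNorm := by
  rw [syn_eq_graphSyn, cycles_eq_graphCycles]
  exact hD.isMinWeight

/-- The star lattice of the torus is link-connected. [cite: DennisEtAl2002, §3.1] -/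
theorem star_isLinkConnected [NeZero L] : IsLinkConnected (starEnds L) :=
  fun a b => exists_chain_of_steps (ι := starEnds L) id (fun b i => ⟨(b, i), rfl⟩) a b

/-- The canonical link metric of the `Z`-sector: lattice (shortest-chain) distance between sites.
(definition) (Korte–Vygen §12.2: metric closure.) [cite: DennisEtAl2002, §4.4 p. 18] -/
noncomputable def starMetric [NeZero L] : EdgeMetric (starEnds L) :=
  chainMetric (starEnds L) (star_isLinkConnected L)

/-- **Non-vacuity**: an MWPM decoder of the star syndrome exists (lattice distance, some tie-break, some
geodesics). [cite: DennisEtAl2002, §4.4 p. 18] -/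
theorem exists_isMatchingDecoder_star [NeZero L] : ∃ D : ZDecoder L, IsMatchingDecoder (starMetric L) D :=
  exists_isMatchingDecoder (star_isLinkConnected L)

/-! ### The plaquette syndrome map (`X`-sector, perfect measurement) -/

/-- The two plaquettes BORDERING the link `(v, i)`, labelled by lower-left corners: `v` and `v - e_{1-i}`
(the plaquettes `P` with `ℓ ∈ ∂P`). [cite: DennisEtAl2002, §3.1 (Z_P = ⊗_{ℓ ∈ P} Z_ℓ)] -/
def plaqEnds (ℓ : Edge L) : Sym2 (Vertex L) :=
  s(ℓ.1, ℓ.1 - dir (Fin.rev ℓ.2))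

/-- **The plaquette check matrix is the incidence matrix of the dual lattice**: `H^Z = incMatrix plaqEnds`.
[cite: DennisEtAl2002, §3.1 (plaquette operators) and §4.1 (dual lattice)] -/
theorem plaquetteMatrix_eq_incMatrix : plaquetteMatrix L = incMatrix (plaqEnds L) := by
  ext w ⟨v, i⟩
  simp only [plaquetteMatrix, incMatrix, of_apply, plaquetteRow, plaqEnds, pairIndicator_mk, Pi.add_apply,
    Pi.single_apply, Prod.mk.injEq]
  have h0 : (v = w + dir 0) ↔ (w = v - dir 0) := by rw [eq_sub_iff_add_eq, eq_comm]
  have h1 : (v = w + dir 1) ↔ (w = v - dir 1) := by rw [eq_sub_iff_add_eq, eq_comm]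
  have h2 : (v = w) ↔ (w = v) := eq_comm
  fin_cases i <;> simp [h0, h1, h2, Fin.rev]

/-- Hence the syndrome map of `X`-errors (`CSSCode.xSyndrome`, `H^Z e`) is the graphlike boundary of
`plaqEnds`. [cite: DennisEtAl2002, §4.1 (X errors: defects on plaquettes)] -/
theorem xSyndrome_eq_graphSyn [NeZero L] : (toricCode L).xSyndrome = graphSyn (plaqEnds L) := by
  funext e
  simp only [CSSCode.xSyndrome, graphSyn, toricCode, plaquetteMatrix_eq_incMatrix]

/-- … and `ker H^Z` is the set of graphlike cycles of `plaqEnds`. [cite: DennisEtAl2002, §4.1] -/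
theorem kerZ_eq_graphCycles [NeZero L] :
    ((toricCode L).kerZ : Set (Chain L)) = graphCycles (plaqEnds L) := by
  ext z
  rw [SetLike.mem_coe, CSSCode.mem_kerZ_iff]
  simp only [graphCycles, Set.mem_setOf_eq, graphSyn, toricCode, plaquetteMatrix_eq_incMatrix]

variable {L} in
/-- **Toric `X`-sector: matching decoders are minimum-weight decoders** (defects on plaquettes, dual-lattice
metric). (Korte–Vygen Thm 12.9.) [cite: DennisEtAl2002, §4.4 p. 18] -/
theorem isMinWeight_of_isMatchingDecoder_plaq [NeZero L] {m : EdgeMetric (plaqEnds L)}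
    {D : Decoder (Syndrome L) (Chain L)} (hD : IsMatchingDecoder m D) :
    D.IsMinWeight (toricCode L).xSyndrome ((toricCode L).kerZ : Set (Chain L)) hammingNorm := by
  rw [xSyndrome_eq_graphSyn, kerZ_eq_graphCycles]
  exact hD.isMinWeight

/-- The dual lattice of the torus is link-connected. [cite: DennisEtAl2002, §4.1 (dual lattice)] -/
theorem plaq_isLinkConnected [NeZero L] : IsLinkConnected (plaqEnds L) := by
  refine fun a b => exists_chain_of_steps (ι := plaqEnds L) id (fun b i => ⟨(b + dir i, Fin.rev i), ?_⟩) a b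
  simp only [plaqEnds, Fin.rev_rev, add_sub_cancel_right, id]
  exact Sym2.eq_swap

/-- The canonical link metric of the `X`-sector: dual-lattice distance between plaquettes. (definition)
[cite: DennisEtAl2002, §4.4 p. 18] -/
noncomputable def plaqMetric [NeZero L] : EdgeMetric (plaqEnds L) :=
  chainMetric (plaqEnds L) (plaq_isLinkConnected L)

/-- **Non-vacuity**: an MWPM decoder of the plaquette syndrome exists. [cite: DennisEtAl2002, §4.4 p. 18] -/
theorem exists_isMatchingDecoder_plaq [NeZero L] :
    ∃ D : Decoder (Syndrome L) (Chain L), IsMatchingDecoder (plaqMetric L) D :=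
  exists_isMatchingDecoder (plaq_isLinkConnected L)

/-! ### The space-time syndrome map (`T` noisy rounds, phenomenological model) -/

variable (T : ℕ)

/-- The two ENDS of a space-time link: the horizontal link `(ℓ, t)` joins the two sites of `ℓ` in slice
`t`; the vertical link `(s, t)` joins `(s, t)` and `(s, t+1)`.
[cite: DennisEtAl2002, §4.2 (spacelike and timelike links of the three-dimensional lattice)] -/
def stLinkEnds : STLink L T → Sym2 (STSite L T) :=
  Sum.elim (fun et => s((et.1.1, et.2.castSucc), (et.1.1 + dir et.1.2, et.2.castSucc)))
    (fun vt => s((vt.1, vt.2.castSucc), (vt.1, vt.2.succ)))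

/-- **The space-time boundary matrix is the incidence matrix of the space-time lattice**:
`stMatrix L T = incMatrix (stLinkEnds L T)`. [cite: DennisEtAl2002, §4.2–4.3 (∂ on the spacetime lattice)] -/
theorem stMatrix_eq_incMatrix : stMatrix L T = incMatrix (stLinkEnds L T) := by
  ext ⟨s, τ⟩ ℓ
  rcases ℓ with ⟨⟨v, i⟩, t⟩ | ⟨v, t⟩
  · -- horizontal link
    simp only [stMatrix, incMatrix, of_apply, Sum.elim_inl, stLinkEnds, pairIndicator_mk, Pi.add_apply,
      Pi.single_apply, Prod.mk.injEq, starMatrix_eq_incMatrix, starEnds]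
    by_cases hτ : τ = t.castSucc <;> simp [hτ]
  · -- vertical link
    simp only [stMatrix, incMatrix, of_apply, Sum.elim_inr, stLinkEnds, pairIndicator_mk, Pi.add_apply,
      Pi.single_apply, Prod.mk.injEq]
    have hne : t.castSucc ≠ t.succ := Fin.castSucc_lt_succ.ne
    by_cases hs : s = v
    · subst hs
      by_cases h1 : τ = t.castSucc
      · subst h1; simp [hne]
      · by_cases h2 : τ = t.succ
        · subst h2; simp [hne.symm]
        · simp [h1, h2]
    · simp [hs]

/-- Hence the space-time boundary map is the graphlike boundary of `stLinkEnds`. [cite: DennisEtAl2002, §4.3 (∂S = ∂E)] -/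
theorem stSyn_eq_graphSyn [NeZero L] : stSyn L T = graphSyn (stLinkEnds L T) := by
  funext E
  simp only [stSyn, graphSyn, stMatrix_eq_incMatrix]

/-- … and the space-time cycles are the graphlike cycles. [cite: DennisEtAl2002, §4.3] -/
theorem stCycles_eq_graphCycles [NeZero L] : stCycles L T = graphCycles (stLinkEnds L T) := by
  ext z
  simp only [stCycles, graphCycles, Set.mem_setOf_eq, stSyn_eq_graphSyn]

variable {L T} in
/-- **Space-time matching decoders are minimum-weight space-time decoders.** For every link metric `m` on
the space-time sites and every decoder matching the syndrome changes by a minimum-cost perfect matching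
realised by geodesics in the three-dimensional lattice (DKLP's recovery procedure for `q = p`),
`D.IsMinWeight (stSyn L T) (stCycles L T) hammingNorm` — the hypothesis of every phenomenological-noise
threshold theorem of the tree. (Korte–Vygen Thm 12.9.) [cite: DennisEtAl2002, §5.1 p. 19 (E_min … [edmonds, barahona_match])] -/
theorem isMinWeight_of_isMatchingDecoder_st [NeZero L] {m : EdgeMetric (stLinkEnds L T)} {D : STDecoder L T}
    (hD : IsMatchingDecoder m D) : D.IsMinWeight (stSyn L T) (stCycles L T) hammingNorm := by
  rw [stSyn_eq_graphSyn, stCycles_eq_graphCycles]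
  exact hD.isMinWeight

/-- The space-time lattice with at least one round is link-connected (walk in slice `0`, then climb the
vertical links). [cite: DennisEtAl2002, §4.2 (three-dimensional lattice)] -/
theorem st_isLinkConnected [NeZero L] [NeZero T] : IsLinkConnected (stLinkEnds L T) := by
  refine isLinkConnected_of_root ((0 : Vertex L), (0 : Fin (T + 1))) fun x => ?_
  obtain ⟨s, τ⟩ := x
  -- horizontal walk in slice 0 from (0,0) to (s,0)
  have hh : ∃ γ : History L T, graphSyn (stLinkEnds L T) γ = pairIndicator s(((0 : Vertex L), (0 : Fin (T + 1))), (s, 0)) := by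
    have := exists_chain_of_steps (ι := stLinkEnds L T) (fun v : Vertex L => (v, (0 : Fin (T + 1))))
      (fun b i => ⟨Sum.inl ((b, i), 0), by simp [stLinkEnds]⟩) 0 s
    simpa using this
  -- vertical climb from (s,0) to (s,τ)
  have hv : ∀ τ' : Fin (T + 1), ∃ γ : History L T,
      graphSyn (stLinkEnds L T) γ = pairIndicator s((s, (0 : Fin (T + 1))), (s, τ')) := by
    intro τ'
    induction τ' using Fin.induction with
    | zero => exact ⟨0, by rw [graphSyn_zero, pairIndicator_diag]⟩
    | succ t ih =>
      obtain ⟨γ, hγ⟩ := ih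
      refine ⟨γ + Pi.single (Sum.inr (s, t)) 1, ?_⟩
      rw [graphSyn_add, graphSyn_single, hγ]
      simp only [stLinkEnds, Sum.elim_inr]
      exact pairIndicator_add_pairIndicator _ _ _
  obtain ⟨γ₁, h₁⟩ := hh
  obtain ⟨γ₂, h₂⟩ := hv τ
  exact ⟨γ₁ + γ₂, by rw [graphSyn_add, h₁, h₂, pairIndicator_add_pairIndicator]⟩

/-- The canonical link metric of the space-time model: lattice distance in the three-dimensional lattice.
(definition) [cite: DennisEtAl2002, §5.1 p. 19] -/
noncomputable def stMetric [NeZero L] [NeZero T] : EdgeMetric (stLinkEnds L T) :=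
  chainMetric (stLinkEnds L T) (st_isLinkConnected L T)

/-- **Non-vacuity**: a space-time MWPM decoder exists for every `T ≥ 1`. [cite: DennisEtAl2002, §5.1 p. 19] -/
theorem exists_isMatchingDecoder_st [NeZero L] [NeZero T] :
    ∃ D : STDecoder L T, IsMatchingDecoder (stMetric L T) D :=
  exists_isMatchingDecoder (st_isLinkConnected L T)

end ToricCode

end Literature.InformationTheory.QuantumCodes
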